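import Summits.KontsevichZagierPeriods.KontsevichZagierPeriods.Theorems.RootDecompRationalCubeDichotomyMonomialDivisionP1

/-! lens-2 g10 MonomialDivision.lean @aa332d15, part 2/3: **P4 `MonomialDivisionAt n` for every `n`** (`monomialDivisionAt_holds`; exact division by a rational coordinate hyperplane preserves étale multi-generator data) — split by the census seat; mathematics unchanged. -/

noncomputable section

set_option linter.dupNamespace false
set_option linter.unusedVariables false
set_option linter.unusedSectionVars false

namespace Summit.KontsevichZagierPeriods.RootDecompRationalCubeDichotomy.Rung24903.MonomialDivision

open MvPolynomial Filter Topology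
open Summit.KontsevichZagierPeriods.RootDecompRationalCubeDichotomy.Rung29430.MultiGen
  (MultiGenData multiGenData_of_pointData ratBox isOpen_ratBox isSemialgebraic_ratBox exists_ratBox_subset)
open Summit.KontsevichZagierPeriods.RootDecompRationalCubeDichotomy.Rung29430.MultiGen.NashImplicit
  (solutions_eq_near)

section Main

variable {n : ℕ}

open Matrix in
/-- **P4 (`MonomialDivisionAt n`, every `n`).**  Token-identical to `EtaleCubeBypass.MonomialDivisionAt n`. -/
theorem monomialDivisionAt_holds (n : ℕ) :
    ∀ (k : ℕ) (g q : (Fin n → ℝ) → ℝ) (x₀ : Fin n → ℝ) (i : Fin n) (c : ℚ), x₀ i = (c : ℝ) →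
      MultiGenData n k g x₀ → AnalyticAt ℝ q x₀ → (∀ᶠ x in nhds x₀, g x = (x i - (c : ℝ)) * q x) →
      ∃ k', MultiGenData n k' q x₀ := by
  intro k g q x₀ i c hx₀ hG hq hgq
  classical
  obtain ⟨V, u, F, A, B, hVo, hx₀V, husa, huan, hFu, hJ, hgAB⟩ := hG
  -- the projection to the hyperplane `x_i = c`
  set π : (Fin n → ℝ) → (Fin n → ℝ) := fun x => Function.update x i (c : ℝ) with hπ_def
  have hπc : Continuous π := continuous_id.update i continuous_const
  have hπi : ∀ x, π x i = (c : ℝ) := fun x => Function.update_self i (c : ℝ) x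
  have hπx₀ : π x₀ = x₀ := by
    show Function.update x₀ i (c : ℝ) = x₀
    rw [← hx₀]; exact Function.update_eq_self i x₀
  have hπfix : ∀ x : Fin n → ℝ, x i = (c : ℝ) → π x = x := by
    intro x hx; show Function.update x i (c : ℝ) = x; rw [← hx]; exact Function.update_eq_self i x
  have hπVo : IsOpen (π ⁻¹' V) := hVo.preimage hπc
  have hx₀πV : x₀ ∈ π ⁻¹' V := by show π x₀ ∈ V; rw [hπx₀]; exact hx₀V
  -- polynomial algebra
  set φ : MvPolynomial (Fin (n + k)) ℚ →ₐ[ℚ] MvPolynomial (Fin (n + k)) ℚ :=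
    MvPolynomial.aeval (substMap n k i c) with hφ_def
  have hdiv : ∀ p : MvPolynomial (Fin (n + k)) ℚ, ∃ q' : MvPolynomial (Fin (n + k)) ℚ,
      p - φ p = (X (Fin.castAdd k i) - C c) * q' :=
    fun p => exists_sub_subst_eq_mul (Fin.castAdd k i) c p
  choose Ψ hΨ using fun m => hdiv (F m)
  obtain ⟨A1, hA1⟩ := hdiv A
  have hdd : ∀ p : MvPolynomial (Fin (n + k)) ℚ, ∃ Φ : Fin k → MvPolynomial (Fin (n + (k + k))) ℚ,
      rename (e₁ n k) p - rename (e₂ n k) p = ∑ j, Φ j * (X (Y n k j) - X (Y' n k j)) :=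
    fun p => exists_divDiff _ _ _ _ e₁_agree_e₂ p
  choose M hM using fun m => hdd (φ (F m))
  obtain ⟨Θ, hΘ⟩ := hdd (φ A)
  let Mp : Matrix (Fin k) (Fin k) (MvPolynomial (Fin (n + (k + k))) ℚ) := Matrix.of fun m j => M m j
  let Ψv : Fin k → MvPolynomial (Fin (n + (k + k))) ℚ := fun m => rename (e₁ n k) (Ψ m)
  let F' : Fin (k + k) → MvPolynomial (Fin (n + (k + k))) ℚ :=
    Fin.append (fun m => rename (e₁ n k) (F m)) (fun m => rename (e₂ n k) (φ (F m)))
  let B' : MvPolynomial (Fin (n + (k + k))) ℚ := rename (e₁ n k) B * Mp.det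
  let A' : MvPolynomial (Fin (n + (k + k))) ℚ :=
    Mp.det * rename (e₁ n k) A1 - ∑ j, Θ j * (Mp.adjugate *ᵥ Ψv) j
  -- the base point
  set y : Fin k → ℝ := fun j => u j x₀ with hy_def
  let y₀ : Fin (k + k) → ℝ := Fin.append y y
  have hz₀ : Fin.append x₀ y₀ = pt3 x₀ y y := rfl
  have hxy₀ : (Fin.append x₀ fun j => u j x₀) = Fin.append x₀ y := rfl
  -- the Jacobian of `g`'s presentation
  set J : Matrix (Fin k) (Fin k) ℝ :=
    Matrix.of fun m j => MvPolynomial.aeval (Fin.append x₀ y) (pderiv (Fin.natAdd n j) (F m)) with hJ_def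
  have hJdet : J.det ≠ 0 := hJ
  -- `φ` does not change values on the hyperplane / Jacobian at `x₀`
  have hφval : ∀ (x : Fin n → ℝ) (w : Fin k → ℝ) (p : MvPolynomial (Fin (n + k)) ℚ),
      MvPolynomial.aeval (Fin.append x w) (φ p) = MvPolynomial.aeval (Fin.append (π x) w) p :=
    fun x w p => aeval_subst i c x w p
  have hφJ : ∀ m j, MvPolynomial.aeval (Fin.append x₀ y) (pderiv (Fin.natAdd n j) (φ (F m))) = J m j := by
    intro m j
    rw [pderiv_subst, hφval, hπx₀, hJ_def, Matrix.of_apply]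
  -- diagonal values of `M` are the Jacobian
  have hMdiag : ∀ m j, MvPolynomial.aeval (pt3 x₀ y y) (M m j) = J m j := by
    intro m j
    rw [← aeval_aeval_dmap, diag_eq_pderiv _ _ (hM m) j, hφJ]
  ----------------------------------------------------------------
  -- (O1) relations at the base point
  have hF' : ∀ m', MvPolynomial.aeval (Fin.append x₀ y₀) (F' m') = 0 := by
    intro m'
    rw [hz₀]
    induction m' using Fin.addCases with
    | left m =>
      simp only [F', Fin.append_left]
      rw [aeval_pt3_rename_e₁]
      exact hFu x₀ hx₀V m
    | right m =>
      simp only [F', Fin.append_right]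
      rw [aeval_pt3_rename_e₂, hφval, hπx₀]
      exact hFu x₀ hx₀V m
  -- (O2) the Jacobian of the doubled system is block-diagonal `J ⊕ J`
  have hJac : ∀ m' j' : Fin (k + k),
      MvPolynomial.aeval (Fin.append x₀ y₀) (pderiv (Fin.natAdd n j') (F' m')) =
        (Matrix.reindex finSumFinEquiv finSumFinEquiv (Matrix.fromBlocks J 0 0 J)) m' j' := by
    intro m' j'
    rw [hz₀, Matrix.reindex_apply, Matrix.submatrix_apply]
    induction m' using Fin.addCases with
    | left m =>
      simp only [F', Fin.append_left, finSumFinEquiv_symm_apply_castAdd]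
      induction j' using Fin.addCases with
      | left j =>
        rw [finSumFinEquiv_symm_apply_castAdd, Matrix.fromBlocks_apply₁₁,
          show Fin.natAdd n (Fin.castAdd k j) = Y n k j from rfl,
          pderiv_rename_of_iff _ _ _ (fun r => e₁_eq_Y_iff r j), aeval_pt3_rename_e₁, hJ_def,
          Matrix.of_apply]
      | right j =>
        rw [finSumFinEquiv_symm_apply_natAdd, Matrix.fromBlocks_apply₁₂,
          show Fin.natAdd n (Fin.natAdd k j) = Y' n k j from rfl,
          pderiv_rename_of_ne _ _ (fun r => e₁_ne_Y' r j), map_zero, Matrix.zero_apply]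
    | right m =>
      simp only [F', Fin.append_right, finSumFinEquiv_symm_apply_natAdd]
      induction j' using Fin.addCases with
      | left j =>
        rw [finSumFinEquiv_symm_apply_castAdd, Matrix.fromBlocks_apply₂₁,
          show Fin.natAdd n (Fin.castAdd k j) = Y n k j from rfl,
          pderiv_rename_of_ne _ _ (fun r => e₂_ne_Y r j), map_zero, Matrix.zero_apply]
      | right j =>
        rw [finSumFinEquiv_symm_apply_natAdd, Matrix.fromBlocks_apply₂₂,
          show Fin.natAdd n (Fin.natAdd k j) = Y' n k j from rfl,
          pderiv_rename_of_iff _ _ _ (fun r => e₂_eq_Y'_iff r j), aeval_pt3_rename_e₂, pderiv_subst,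
          hφval, hπx₀, hJ_def, Matrix.of_apply]
  have hJ' : (Matrix.of fun m' j' : Fin (k + k) =>
      MvPolynomial.aeval (Fin.append x₀ y₀) (pderiv (Fin.natAdd n j') (F' m'))).det ≠ 0 := by
    have : (Matrix.of fun m' j' : Fin (k + k) =>
        MvPolynomial.aeval (Fin.append x₀ y₀) (pderiv (Fin.natAdd n j') (F' m'))) =
        Matrix.reindex finSumFinEquiv finSumFinEquiv (Matrix.fromBlocks J 0 0 J) :=
      Matrix.ext fun m' j' => by rw [Matrix.of_apply]; exact hJac m' j'
    rw [this, Matrix.det_reindex_self, Matrix.det_fromBlocks_zero₂₁]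
    exact mul_ne_zero hJdet hJdet
  -- (O3) `B' ≠ 0` at the base point
  have hdetM₀ : MvPolynomial.aeval (pt3 x₀ y y) Mp.det = J.det := by
    rw [AlgHom.map_det]
    congr 1
    ext m j
    rw [AlgHom.mapMatrix_apply, Matrix.map_apply]
    exact hMdiag m j
  have hB' : MvPolynomial.aeval (Fin.append x₀ y₀) B' ≠ 0 := by
    rw [hz₀]
    simp only [B', map_mul]
    rw [aeval_pt3_rename_e₁, hdetM₀]
    exact mul_ne_zero (hgAB x₀ hx₀V).1 hJdet
  ----------------------------------------------------------------
  refine ⟨k + k, multiGenData_of_pointData y₀ F' A' B' hF' hJ' hB' ?_⟩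
  intro V₁ v hV₁o hx₀V₁ hv₀ hvan hFv
  -- the two halves of the solution `v`
  have hFv₁ : ∀ x ∈ V₁, ∀ m, MvPolynomial.aeval (Fin.append x fun j => v (Fin.castAdd k j) x) (F m) = 0 := by
    intro x hx m
    have h := hFv x hx (Fin.castAdd k m)
    simp only [F', Fin.append_left] at h
    rwa [append_eq_pt3, aeval_pt3_rename_e₁] at h
  have hFv₂ : ∀ x ∈ V₁, ∀ m,
      MvPolynomial.aeval (Fin.append x fun j => v (Fin.natAdd k j) x) (φ (F m)) = 0 := by
    intro x hx m
    have h := hFv x hx (Fin.natAdd k m)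
    simp only [F', Fin.append_right] at h
    rwa [append_eq_pt3, aeval_pt3_rename_e₂] at h
  -- first half = u near x₀
  obtain ⟨W₁, hW₁o, hx₀W₁, hW₁sub, hW₁⟩ := solutions_eq_near F x₀ y hJdet (V := V ∩ V₁)
    (hVo.inter hV₁o) ⟨hx₀V, hx₀V₁⟩ (u := u) (v := fun j => v (Fin.castAdd k j))
    (fun j => rfl) (fun j => by rw [hv₀]; exact Fin.append_left y y j)
    (fun j => (huan j x₀ hx₀V).continuousAt) (fun j => (hvan _ x₀ hx₀V₁).continuousAt)
    (fun x hx m => hFu x hx.1 m) (fun x hx m => hFv₁ x hx.2 m)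
  -- second half = u ∘ π near x₀
  have hJφ : (Matrix.of fun m j : Fin k =>
      MvPolynomial.aeval (Fin.append x₀ y) (pderiv (Fin.natAdd n j) (φ (F m)))).det ≠ 0 := by
    have : (Matrix.of fun m j : Fin k =>
        MvPolynomial.aeval (Fin.append x₀ y) (pderiv (Fin.natAdd n j) (φ (F m)))) = J :=
      Matrix.ext fun m j => by rw [Matrix.of_apply]; exact hφJ m j
    rw [this]; exact hJdet
  obtain ⟨W₂, hW₂o, hx₀W₂, hW₂sub, hW₂⟩ := solutions_eq_near (fun m => φ (F m)) x₀ y hJφ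
    (V := π ⁻¹' V ∩ V₁) (hπVo.inter hV₁o) ⟨hx₀πV, hx₀V₁⟩ (u := fun j x => u j (π x))
    (v := fun j => v (Fin.natAdd k j))
    (fun j => by show u j (π x₀) = y j; rw [hπx₀]) (fun j => by rw [hv₀]; exact Fin.append_right y y j)
    (fun j => by
      have h1 : ContinuousAt (u j) (π x₀) := (huan j (π x₀) (by rw [hπx₀]; exact hx₀V)).continuousAt
      exact h1.comp hπc.continuousAt)
    (fun j => (hvan _ x₀ hx₀V₁).continuousAt)
    (fun x hx m => by rw [hφval]; exact hFu (π x) hx.1 m) (fun x hx m => hFv₂ x hx.2 m)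
  -- the set where `g = (x_i - c) q` and `q` is analytic
  obtain ⟨W₀, hW₀sub, hW₀o, hx₀W₀⟩ := _root_.mem_nhds_iff.1 (hgq.and hq.eventually_analyticAt)
  -- continuity of the evaluated polynomials on `O = V ∩ π⁻¹ V`
  set O : Set (Fin n → ℝ) := V ∩ π ⁻¹' V with hO_def
  have hOo : IsOpen O := hVo.inter hπVo
  set Z : (Fin n → ℝ) → (Fin (n + (k + k)) → ℝ) :=
    fun x => pt3 x (fun j => u j x) (fun j => u j (π x)) with hZ_def
  have hZc : ContinuousOn Z O := by
    refine continuousOn_pt3 (fun j => (huan j).continuousOn.mono Set.inter_subset_left) (fun j => ?_)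
    exact ((huan j).continuousOn.comp hπc.continuousOn fun x hx => hx.2).mono le_rfl
  have hevc : ∀ P : MvPolynomial (Fin (n + (k + k))) ℚ,
      ContinuousOn (fun x => MvPolynomial.aeval (Z x) P) O :=
    fun P => (continuous_aeval_real P).comp_continuousOn hZc
  set b : (Fin n → ℝ) → ℝ := fun x => MvPolynomial.aeval (Z x) B' with hb_def
  set a : (Fin n → ℝ) → ℝ := fun x => MvPolynomial.aeval (Z x) A' with ha_def
  have hbO : IsOpen (O ∩ b ⁻¹' {0}ᶜ) := (hevc B').isOpen_inter_preimage hOo isOpen_compl_singleton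
  have hZx₀ : Z x₀ = pt3 x₀ y y := by
    show pt3 x₀ (fun j => u j x₀) (fun j => u j (π x₀)) = pt3 x₀ y y
    rw [hπx₀]
  have hbx₀ : b x₀ ≠ 0 := by
    show MvPolynomial.aeval (Z x₀) B' ≠ 0
    rw [hZx₀, ← hz₀]; exact hB'
  -- the final neighbourhood
  set V' : Set (Fin n → ℝ) := (W₁ ∩ W₂) ∩ (W₀ ∩ π ⁻¹' W₀) ∩ (O ∩ b ⁻¹' {0}ᶜ) with hV'_def
  have hV'o : IsOpen V' :=
    ((hW₁o.inter hW₂o).inter (hW₀o.inter (hW₀o.preimage hπc))).inter hbO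
  have hx₀V' : x₀ ∈ V' := by
    refine ⟨⟨⟨hx₀W₁, hx₀W₂⟩, hx₀W₀, ?_⟩, ⟨hx₀V, hx₀πV⟩, hbx₀⟩
    show π x₀ ∈ W₀; rw [hπx₀]; exact hx₀W₀
  ----------------------------------------------------------------
  -- the identity `det M(x) · A(x, u x) = (x_i - c) · a x` on `V'`
  have hPID : ∀ x ∈ V', MvPolynomial.aeval (Z x) Mp.det *
      MvPolynomial.aeval (Fin.append x fun j => u j x) A = (x i - (c : ℝ)) * a x := by
    intro x hx
    have hxV : x ∈ V := hx.2.1.1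
    have hπxV : π x ∈ V := hx.2.1.2
    have hπxW₀ : π x ∈ W₀ := hx.1.2.2
    -- notation
    set w : Fin k → ℝ := fun j => u j x with hw_def
    set w' : Fin k → ℝ := fun j => u j (π x) with hw'_def
    have hZx : Z x = pt3 x w w' := rfl
    set t : ℝ := x i - (c : ℝ) with ht_def
    have ht : MvPolynomial.aeval (Fin.append x w) (X (Fin.castAdd k i) - C c : MvPolynomial (Fin (n + k)) ℚ) = t := by
      rw [map_sub, MvPolynomial.aeval_X, Fin.append_left, MvPolynomial.aeval_C]; rfl
    -- real matrices
    set Mz : Matrix (Fin k) (Fin k) ℝ := Mp.map (MvPolynomial.aeval (Z x)) with hMz_def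
    set Ψz : Fin k → ℝ := fun m => MvPolynomial.aeval (Z x) (Ψv m) with hΨz_def
    set Θz : Fin k → ℝ := fun j => MvPolynomial.aeval (Z x) (Θ j) with hΘz_def
    set d : Fin k → ℝ := fun j => w j - w' j with hd_def
    -- g vanishes on the hyperplane, hence so does A(π x, u (π x))
    have hgπ : g (π x) = 0 := by
      have := (hW₀sub hπxW₀).1
      rw [this, hπi, sub_self, zero_mul]
    have hAπ : MvPolynomial.aeval (Fin.append (π x) w') A = 0 := by
      have h := (hgAB (π x) hπxV)
      rw [hgπ] at h
      rcases h with ⟨hBne, hdivi⟩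
      rcases div_eq_zero_iff.1 hdivi.symm with h0 | h0
      · exact h0
      · exact absurd h0 hBne
    -- (1) the vector identity `Mz (w - w') = -t Ψz`
    have hvec : Mz *ᵥ d = -(t • Ψz) := by
      funext m
      have h1 := congrArg (MvPolynomial.aeval (Fin.append x w)) (hΨ m)
      rw [map_sub, map_mul, ht, hFu x hxV m, zero_sub] at h1
      -- h1 : -(φ F_m)(x,w) = t * Ψ_m(x,w)
      have h2 := congrArg (MvPolynomial.aeval (pt3 x w w')) (hM m)
      rw [map_sub, aeval_pt3_rename_e₁, aeval_pt3_rename_e₂, hφval x w', hFu (π x) hπxV m, sub_zero,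
        map_sum] at h2
      -- h2 : (φ F_m)(x,w) = Σ_j M(z) (w_j - w'_j)
      simp only [Matrix.mulVec, dotProduct, Pi.neg_apply, Pi.smul_apply, smul_eq_mul]
      have h3 : ∀ j, Mz m j * d j = MvPolynomial.aeval (pt3 x w w') (M m j * (X (Y n k j) - X (Y' n k j))) := by
        intro j
        rw [map_mul, map_sub, MvPolynomial.aeval_X, MvPolynomial.aeval_X, pt3_Y, pt3_Y']
        rfl
      rw [Finset.sum_congr rfl fun j _ => h3 j, ← h2]
      have h4 : Ψz m = MvPolynomial.aeval (Fin.append x w) (Ψ m) := by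
        show MvPolynomial.aeval (Z x) (rename (e₁ n k) (Ψ m)) = _
        rw [hZx, aeval_pt3_rename_e₁]
      rw [h4]; linarith
    -- (2) Cramer
    have hcr : Mz.det • d = -(t • (Mz.adjugate *ᵥ Ψz)) := by
      calc Mz.det • d = (Mz.det • (1 : Matrix (Fin k) (Fin k) ℝ)) *ᵥ d := by
            rw [Matrix.smul_mulVec, Matrix.one_mulVec]
        _ = (Mz.adjugate * Mz) *ᵥ d := by rw [Matrix.adjugate_mul]
        _ = Mz.adjugate *ᵥ (Mz *ᵥ d) := by rw [Matrix.mulVec_mulVec]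
        _ = -(t • (Mz.adjugate *ᵥ Ψz)) := by rw [hvec, Matrix.mulVec_neg, Matrix.mulVec_smul]
    have hdj : ∀ j, Mz.det * d j = -(t * (Mz.adjugate *ᵥ Ψz) j) := by
      intro j
      have := congrFun hcr j
      simpa only [Pi.smul_apply, Pi.neg_apply, smul_eq_mul] using this
    -- (3) the A-side: `A(x,w) = t A1(x,w) + Σ Θz_j d_j`
    have hAeq : MvPolynomial.aeval (Fin.append x w) A =
        t * MvPolynomial.aeval (Fin.append x w) A1 + ∑ j, Θz j * d j := by
      have h1 := congrArg (MvPolynomial.aeval (Fin.append x w)) hA1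
      rw [map_sub, map_mul, ht] at h1
      have h2 := congrArg (MvPolynomial.aeval (pt3 x w w')) hΘ
      rw [map_sub, aeval_pt3_rename_e₁, aeval_pt3_rename_e₂, hφval x w', hAπ, sub_zero, map_sum] at h2
      have h3 : ∀ j, Θz j * d j = MvPolynomial.aeval (pt3 x w w') (Θ j * (X (Y n k j) - X (Y' n k j))) := by
        intro j
        rw [map_mul, map_sub, MvPolynomial.aeval_X, MvPolynomial.aeval_X, pt3_Y, pt3_Y']
      rw [Finset.sum_congr rfl fun j _ => h3 j, ← h2]
      linarith
    -- (4) evaluation of `A'`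
    have ha : a x = MvPolynomial.aeval (Z x) Mp.det * MvPolynomial.aeval (Fin.append x w) A1 -
        ∑ j, Θz j * (Mz.adjugate *ᵥ Ψz) j := by
      show MvPolynomial.aeval (Z x) A' = _
      simp only [A', map_sub, map_mul, map_sum]
      congr 1
      · rw [hZx, aeval_pt3_rename_e₁]
      · refine Finset.sum_congr rfl fun j _ => ?_
        congr 1
        have hmv := RingHom.map_mulVec (MvPolynomial.aeval (Z x) :
          MvPolynomial (Fin (n + (k + k))) ℚ →ₐ[ℚ] ℝ).toRingHom Mp.adjugate Ψv j
        rw [AlgHom.toRingHom_eq_coe, RingHom.coe_coe] at hmv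
        rw [hmv]
        have hadj : Mp.adjugate.map (MvPolynomial.aeval (Z x)) = Mz.adjugate := by
          have := RingHom.map_adjugate (MvPolynomial.aeval (Z x) :
            MvPolynomial (Fin (n + (k + k))) ℚ →ₐ[ℚ] ℝ).toRingHom Mp
          rw [RingHom.mapMatrix_apply, RingHom.mapMatrix_apply, AlgHom.toRingHom_eq_coe,
            RingHom.coe_coe] at this
          rw [this]
        rw [hadj]
        rfl
    -- (5) assemble
    have hdetMz : MvPolynomial.aeval (Z x) Mp.det = Mz.det := by
      rw [AlgHom.map_det, AlgHom.mapMatrix_apply]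
    rw [ha, hAeq, hdetMz, mul_add, Finset.mul_sum]
    have h5 : ∀ j, Mz.det * (Θz j * d j) = -(t * (Θz j * (Mz.adjugate *ᵥ Ψz) j)) := by
      intro j
      rw [mul_left_comm, hdj j]; ring
    rw [Finset.sum_congr rfl fun j _ => h5 j, Finset.sum_neg_distrib, ← Finset.mul_sum, mul_sub,
      Finset.mul_sum]
    ring
  ----------------------------------------------------------------
  -- `h = q b - a` vanishes on `V'`
  have hqc : ContinuousOn q W₀ :=
    continuousOn_of_forall_continuousAt fun x hx => (hW₀sub hx).2.continuousAt
  have hhc : ContinuousOn (fun x => q x * b x - a x) V' :=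
    ((hqc.mono fun x hx => hx.1.2.1).mul ((hevc B').mono fun x hx => hx.2.1)).sub
      ((hevc A').mono fun x hx => hx.2.1)
  have hmul : ∀ x ∈ V', (x i - (c : ℝ)) * (q x * b x - a x) = 0 := by
    intro x hx
    have hxV : x ∈ V := hx.2.1.1
    have hxW₀ : x ∈ W₀ := hx.1.2.1
    have hgx : g x = (x i - (c : ℝ)) * q x := (hW₀sub hxW₀).1
    obtain ⟨hBx, hgABx⟩ := hgAB x hxV
    have hgB : g x * MvPolynomial.aeval (Fin.append x fun j => u j x) B =
        MvPolynomial.aeval (Fin.append x fun j => u j x) A := by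
      rw [hgABx]; field_simp
    have hb : b x = MvPolynomial.aeval (Fin.append x fun j => u j x) B * MvPolynomial.aeval (Z x) Mp.det := by
      show MvPolynomial.aeval (Z x) B' = _
      simp only [B', map_mul]
      rw [show Z x = pt3 x (fun j => u j x) (fun j => u j (π x)) from rfl, aeval_pt3_rename_e₁]
    have hP := hPID x hx
    rw [mul_sub, hb, ← hP]
    calc (x i - (c : ℝ)) * (q x * (MvPolynomial.aeval (Fin.append x fun j => u j x) B *
            MvPolynomial.aeval (Z x) Mp.det)) -
          MvPolynomial.aeval (Z x) Mp.det * MvPolynomial.aeval (Fin.append x fun j => u j x) A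
        = (g x * MvPolynomial.aeval (Fin.append x fun j => u j x) B) * MvPolynomial.aeval (Z x) Mp.det -
          MvPolynomial.aeval (Z x) Mp.det * MvPolynomial.aeval (Fin.append x fun j => u j x) A := by
          rw [hgx]; ring
      _ = 0 := by rw [hgB]; ring
  have hzero : ∀ x ∈ V', q x * b x - a x = 0 := by
    intro x hx
    by_cases hxi : x i = (c : ℝ)
    · -- approach `x` along the `x_i`-direction
      set γ : ℝ → (Fin n → ℝ) := fun s => Function.update x i ((c : ℝ) + s) with hγ_def
      have hγc : Continuous γ := continuous_const.update i (continuous_const.add continuous_id)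
      have hγ0 : γ 0 = x := by
        show Function.update x i ((c : ℝ) + 0) = x
        rw [add_zero, ← hxi]; exact Function.update_eq_self i x
      have hγt : Tendsto γ (𝓝[≠] (0 : ℝ)) (𝓝 x) := by
        have : Tendsto γ (𝓝 0) (𝓝 (γ 0)) := hγc.continuousAt
        rw [hγ0] at this
        exact this.mono_left nhdsWithin_le_nhds
      have hev : ∀ᶠ s in 𝓝[≠] (0 : ℝ), (fun x => q x * b x - a x) (γ s) = 0 := by
        have h1 : ∀ᶠ s in 𝓝[≠] (0 : ℝ), γ s ∈ V' := hγt (hV'o.mem_nhds hx)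
        have h2 : ∀ᶠ s in 𝓝[≠] (0 : ℝ), s ≠ 0 := self_mem_nhdsWithin
        filter_upwards [h1, h2] with s hs1 hs2
        have hne : γ s i - (c : ℝ) ≠ 0 := by
          show Function.update x i ((c : ℝ) + s) i - (c : ℝ) ≠ 0
          rw [Function.update_self]; simpa using hs2
        have := hmul (γ s) hs1
        exact (mul_eq_zero.1 this).resolve_left hne
      have hlim1 : Tendsto (fun s => (fun x => q x * b x - a x) (γ s)) (𝓝[≠] (0 : ℝ))
          (𝓝 ((fun x => q x * b x - a x) x)) :=
        ((hhc.continuousAt (hV'o.mem_nhds hx)).tendsto).comp hγt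
      have hlim2 : Tendsto (fun s => (fun x => q x * b x - a x) (γ s)) (𝓝[≠] (0 : ℝ)) (𝓝 0) :=
        tendsto_const_nhds.congr' (hev.mono fun s hs => hs.symm)
      exact tendsto_nhds_unique hlim1 hlim2
    · have := hmul x hx
      exact (mul_eq_zero.1 this).resolve_left (sub_ne_zero.2 hxi)
  ----------------------------------------------------------------
  refine ⟨V', fun x hx => (hW₁sub hx.1.1.1).2, hV'o, hx₀V', fun x hx => ?_⟩
  have hbx : b x ≠ 0 := hx.2.2
  -- the solution `v` equals `(u, u ∘ π)` on `V'`
  have hvZ : (Fin.append x fun j' => v j' x) = Z x := by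
    rw [append_eq_pt3]
    show pt3 x (fun j => v (Fin.castAdd k j) x) (fun j => v (Fin.natAdd k j) x) =
      pt3 x (fun j => u j x) (fun j => u j (π x))
    congr 1
    · funext j; exact (hW₁ x hx.1.1.1 j).symm
    · funext j; exact (hW₂ x hx.1.1.2 j).symm
  rw [hvZ, eq_div_iff hbx]
  exact sub_eq_zero.1 (hzero x hx)

end Main

end Summit.KontsevichZagierPeriods.RootDecompRationalCubeDichotomy.Rung24903.MonomialDivision

end
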